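import Summits.Ventures.DiscreteObjects.PP12.PlanarExterior
import Summits.Ventures.DiscreteObjects.PP12.OrderFive

/-!
# PP(12), order-5 cell: the tangent/exterior structure around the fixed Fano subplane (kernel)
Framing: lottery ticket; floor = certified bounds/negative ranges.

Setting: a collineation `σ` of a projective plane of order 12 (Mathlib `Configuration.ProjectivePlane`) whose fixed structure is a
FANO SUBPLANE — exactly 7 fixed points and 7 fixed lines, 3 fixed points on every fixed line, 3 fixed lines through every fixed
point. By `OrderFive.fano_of_pow_five` (p220694) this is exactly the fixed structure of any `σ ≠ 1` with `σ⁵ = 1` on a plane of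
order 12 (Janko–van Trung's `p = 5` case, excluded in print: Geom. Dedicata 12 (1982) 101–110, by a computer elimination). The
hypotheses below are that output; the order of `σ` is not used. This file is the first layer of the orbit-matrix ('tactical
decomposition') analysis of that cell (cell pub-namedobj, target M, designs g10, FAMILY P5-PLANE §1):

* TANGENT points (non-fixed, on a fixed line) number `70` (`card_tangent_points_fano`), EXTERIOR points (on no fixed line)
  number `80` (`card_exterior_points_fano`);
* a line through an exterior point carries at most one fixed point (`fixedOnLine_le_one_of_exterior`); exactly `7` of the 13 lines
  through an exterior point carry a fixed point and exactly `6` carry none (`lines_through_exterior_fano`);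
* the line counts (tangent line 1 + 4 + 8, exterior line 7 + 6), the packaged statement for `σ⁵ = 1` and the dual counts are in
  the sequel `FanoExteriorLines.lean`.

Everything is elementary counting (two fixed lines meet in a fixed point, two fixed points span a fixed line); no `sorry`, no new
axioms. The general lemmas `fixed_line_unique_of_not_fixed` / `fixed_point_unique_of_not_fixed` are reused from `PlanarExterior`.
-/

namespace Summit.Ventures.DiscreteObjects.PP12

open Configuration Finset
open scoped Classical

namespace Collineation

variable {P L : Type*} [Membership P L] [ProjectivePlane P L] [Fintype P] [Fintype L]
  [DecidableEq P] [DecidableEq L] (σ : Collineation P L)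

omit [Fintype P] [Fintype L] [DecidableEq P] [DecidableEq L] in
/-- A line through a point lying on no fixed line carries at most one fixed point (two fixed points span a fixed line). -/
theorem fixedOnLine_le_one_of_exterior [Fintype P] [DecidableEq P] {E : P} (hE : ∀ l : L, σ.onLines l = l → E ∉ l)
    {m : L} (hEm : E ∈ m) : σ.fixedOnLine m ≤ 1 := by
  unfold fixedOnLine
  refine Finset.card_le_one.mpr fun a ha b hb => ?_
  simp only [mem_filter, mem_univ, true_and] at ha hb
  by_contra hab
  exact hE m (σ.line_fixed_of_two_fixed ha.1 hb.1 hab ha.2 hb.2) hEm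

section Fano

variable (h12 : ProjectivePlane.order P L = 12)
include h12

/-- **Tangent points: 70.** The non-fixed points lying on a fixed line are partitioned by the 7 fixed lines, 10 on each. -/
theorem card_tangent_points_fano (hg7 : fixedCard σ.onLines = 7) (hk3 : ∀ l : L, σ.onLines l = l → σ.fixedOnLine l = 3) :
    (univ.filter fun x : P => σ.onPoints x ≠ x ∧ ∃ l : L, σ.onLines l = l ∧ x ∈ l).card = 70 := by
  set Tn : Finset P := univ.filter fun x : P => σ.onPoints x ≠ x ∧ ∃ l : L, σ.onLines l = l ∧ x ∈ l with hTn
  set T : Finset L := univ.filter fun m : L => σ.onLines m = m with hT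
  have hTcard : T.card = 7 := hg7
  have hLpos : 0 < Fintype.card L := by rw [ProjectivePlane.card_lines P L]; positivity
  obtain ⟨l₀⟩ := Fintype.card_pos_iff.mp hLpos
  -- the fixed line of a tangent point
  let φ : P → L := fun x => if h : ∃ l : L, σ.onLines l = l ∧ x ∈ l then h.choose else l₀
  have hφ : ∀ x ∈ Tn, σ.onLines (φ x) = φ x ∧ x ∈ φ x := by
    intro x hx
    have hx' := (Finset.mem_filter.mp hx).2
    simp only [φ, dif_pos hx'.2]
    exact hx'.2.choose_spec
  have hmaps : ∀ x ∈ Tn, φ x ∈ T := fun x hx => by simp [hT, (hφ x hx).1]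
  have hfib : ∀ m ∈ T, (Tn.filter fun x => φ x = m).card = 10 := by
    intro m hm
    have fm : σ.onLines m = m := by simpa [hT] using hm
    have hset : (Tn.filter fun x => φ x = m)
        = (univ.filter fun x : P => x ∈ m) \ (univ.filter fun x : P => x ∈ m ∧ σ.onPoints x = x) := by
      ext x
      simp only [mem_filter, mem_univ, true_and, mem_sdiff, not_and, hTn]
      constructor
      · rintro ⟨⟨hx, hex⟩, hxm⟩
        have h := hφ x (by simp [hTn, hx, hex])
        rw [hxm] at h
        exact ⟨h.2, fun _ => hx⟩
      · rintro ⟨hxm, hx⟩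
        have hx' : σ.onPoints x ≠ x := fun e => hx hxm e
        have hmem : x ∈ Tn := by simp only [hTn, mem_filter, mem_univ, true_and]; exact ⟨hx', m, fm, hxm⟩
        refine ⟨⟨hx', m, fm, hxm⟩, ?_⟩
        have h := hφ x hmem
        exact σ.fixed_line_unique_of_not_fixed hx' h.1 fm h.2 hxm
    have hsub : (univ.filter fun x : P => x ∈ m ∧ σ.onPoints x = x) ⊆ univ.filter fun x : P => x ∈ m :=
      fun x hx => by simp only [mem_filter, mem_univ, true_and] at hx ⊢; exact hx.1
    have hall : (univ.filter fun x : P => x ∈ m).card = 13 := by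
      rw [← Fintype.card_subtype, ← Nat.card_eq_fintype_card]
      change Configuration.pointCount P m = 13
      rw [ProjectivePlane.pointCount_eq P m, h12]
    have hk : (univ.filter fun x : P => x ∈ m ∧ σ.onPoints x = x).card = 3 := hk3 m fm
    rw [hset, Finset.card_sdiff_of_subset hsub, hall, hk]
  have hsum := Finset.card_eq_sum_card_fiberwise hmaps
  rw [Finset.sum_congr rfl hfib, Finset.sum_const, hTcard] at hsum
  simpa using hsum

/-- **Exterior points: 80** (`157 − 7 − 70`). -/
theorem card_exterior_points_fano (hf7 : fixedCard σ.onPoints = 7) (hg7 : fixedCard σ.onLines = 7)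
    (hk3 : ∀ l : L, σ.onLines l = l → σ.fixedOnLine l = 3) :
    (univ.filter fun x : P => σ.onPoints x ≠ x ∧ ∀ l : L, σ.onLines l = l → x ∉ l).card = 80 := by
  have h70 := σ.card_tangent_points_fano h12 hg7 hk3
  have hN : (univ.filter fun x : P => σ.onPoints x ≠ x).card = 150 := by
    have hsplit := Finset.card_filter_add_card_filter_not (s := (univ : Finset P)) (fun x : P => σ.onPoints x = x)
    rw [Finset.card_univ, ProjectivePlane.card_points P L, h12] at hsplit
    change fixedCard σ.onPoints + _ = _ at hsplit
    rw [hf7] at hsplit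
    norm_num at hsplit
    convert (by omega : (univ.filter fun x : P => ¬ σ.onPoints x = x).card = 150) using 2
  have hsplit := Finset.card_filter_add_card_filter_not (s := univ.filter fun x : P => σ.onPoints x ≠ x)
    (fun x : P => ∃ l : L, σ.onLines l = l ∧ x ∈ l)
  rw [Finset.filter_filter, Finset.filter_filter, hN, h70] at hsplit
  have e : (univ.filter fun x : P => σ.onPoints x ≠ x ∧ ¬ ∃ l : L, σ.onLines l = l ∧ x ∈ l)
      = univ.filter fun x : P => σ.onPoints x ≠ x ∧ ∀ l : L, σ.onLines l = l → x ∉ l := by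
    ext x; simp only [mem_filter, mem_univ, true_and, not_exists, not_and]
  rw [e] at hsplit
  omega

/-- **Lines through an exterior point.** If `E` lies on no fixed line then `E` is not fixed, exactly `7` of the 13 lines through
`E` carry a fixed point (one each: the lines `EX`, `X` fixed) and exactly `6` carry none. -/
theorem lines_through_exterior_fano (hf7 : fixedCard σ.onPoints = 7) {E : P} (hE : ∀ l : L, σ.onLines l = l → E ∉ l) :
    σ.onPoints E ≠ E ∧
    (univ.filter fun m : L => E ∈ m ∧ ∃ x : P, σ.onPoints x = x ∧ x ∈ m).card = 7 ∧
    (univ.filter fun m : L => E ∈ m ∧ ∀ x : P, σ.onPoints x = x → x ∉ m).card = 6 := by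
  set S : Finset P := univ.filter fun x : P => σ.onPoints x = x with hS
  have hScard : S.card = 7 := hf7
  have hEfix : σ.onPoints E ≠ E := by
    intro e
    obtain ⟨X, hX, X', hX', hXX'⟩ := Finset.one_lt_card.mp (by rw [hScard]; norm_num : 1 < S.card)
    have fX : σ.onPoints X = X := by simpa [hS] using hX
    by_cases hEX : E = X
    · subst hEX
      exact hE _ (σ.line_fixed_of_two_fixed (HasLines.mkLine_ax (L := L) hXX').1 (HasLines.mkLine_ax hXX').2 hXX'
        fX (by simpa [hS] using hX')) (HasLines.mkLine_ax hXX').1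
    · exact hE _ (σ.line_fixed_of_two_fixed (HasLines.mkLine_ax (L := L) hEX).1 (HasLines.mkLine_ax hEX).2 hEX e fX)
        (HasLines.mkLine_ax hEX).1
  -- lines through E
  set LE : Finset L := univ.filter fun m' : L => E ∈ m' with hLE
  have hLE13 : LE.card = 13 := by
    rw [hLE, ← Fintype.card_subtype, ← Nat.card_eq_fintype_card]
    change Configuration.lineCount L E = 13
    rw [ProjectivePlane.lineCount_eq L E, h12]
  -- the map X ↦ EX is injective on S and its image is exactly the set of lines through E with a fixed point
  have hLpos : 0 < Fintype.card L := by rw [ProjectivePlane.card_lines P L]; positivity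
  obtain ⟨l₀⟩ := Fintype.card_pos_iff.mp hLpos
  let g : P → L := fun X => if h : E = X then l₀ else HasLines.mkLine h
  have hg : ∀ X ∈ S, E ∈ g X ∧ X ∈ g X := by
    intro X hX
    have fX : σ.onPoints X = X := by simpa [hS] using hX
    have hEX : E ≠ X := fun e => hEfix (e ▸ fX)
    simp only [g, dif_neg hEX]
    exact HasLines.mkLine_ax hEX
  set LT : Finset L := univ.filter fun m : L => E ∈ m ∧ ∃ x : P, σ.onPoints x = x ∧ x ∈ m with hLT
  have hmaps : ∀ X ∈ S, g X ∈ LT := fun X hX => by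
    have fX : σ.onPoints X = X := by simpa [hS] using hX
    simp only [hLT, mem_filter, mem_univ, true_and]
    exact ⟨(hg X hX).1, X, fX, (hg X hX).2⟩
  have hinj : Set.InjOn g S := by
    intro X hX X' hX' heq
    by_contra hXX'
    have fX : σ.onPoints X = X := by simpa [hS] using hX
    have fX' : σ.onPoints X' = X' := by simpa [hS] using hX'
    obtain ⟨hEm', hXm'⟩ := hg X hX
    obtain ⟨-, hX'm'⟩ := hg X' hX'
    rw [← heq] at hX'm'
    have h2 : 2 ≤ σ.fixedOnLine (g X) := by
      unfold fixedOnLine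
      have hsub : ({X, X'} : Finset P) ⊆ univ.filter fun x : P => x ∈ g X ∧ σ.onPoints x = x := by
        intro x hx
        simp only [Finset.mem_insert, Finset.mem_singleton] at hx
        rcases hx with rfl | rfl <;> simp [hXm', hX'm', fX, fX']
      have := Finset.card_le_card hsub
      rwa [Finset.card_pair hXX'] at this
    have := σ.fixedOnLine_le_one_of_exterior hE hEm'
    omega
  -- surjectivity onto LT: a line through E with a fixed point X equals g X
  have himg : S.image g = LT := by
    apply Finset.Subset.antisymm
    · intro m' hm'
      obtain ⟨X, hX, rfl⟩ := Finset.mem_image.mp hm'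
      exact hmaps X hX
    · intro m' hm'
      simp only [hLT, mem_filter, mem_univ, true_and] at hm'
      obtain ⟨hEm', X, fX, hXm'⟩ := hm'
      have hXS : X ∈ S := by simpa [hS] using fX
      have hEX : E ≠ X := fun e => hEfix (e ▸ fX)
      have : g X = m' := by
        obtain ⟨hEg, hXg⟩ := hg X hXS
        exact (Nondegenerate.eq_or_eq hEg hXg hEm' hXm').resolve_left hEX
      exact Finset.mem_image.mpr ⟨X, hXS, this⟩
  have hLT7 : LT.card = 7 := by rw [← himg, Finset.card_image_of_injOn hinj, hScard]
  -- the complement inside LE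
  have hsub : LT ⊆ LE := fun m hm => by
    simp only [hLT, hLE, mem_filter, mem_univ, true_and] at hm ⊢; exact hm.1
  have hdiff : (univ.filter fun m : L => E ∈ m ∧ ∀ x : P, σ.onPoints x = x → x ∉ m) = LE \ LT := by
    ext m
    simp only [hLE, hLT, mem_filter, mem_univ, true_and, mem_sdiff, not_and, not_exists]
    constructor
    · rintro ⟨hEm, hno⟩; exact ⟨hEm, fun _ x fx hxm => hno x fx hxm⟩
    · rintro ⟨hEm, hno⟩; exact ⟨hEm, fun x fx hxm => hno hEm x fx hxm⟩
  refine ⟨hEfix, hLT7, ?_⟩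
  rw [hdiff, Finset.card_sdiff_of_subset hsub, hLE13, hLT7]

end Fano

end Collineation

end Summit.Ventures.DiscreteObjects.PP12
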